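import Mathlib
import Literature.Combinatorics.Additive.TripleProductProperty
import Literature.Computability.AlgebraicComplexity.GroupTheoreticMatMul
import Literature.Computability.AlgebraicComplexity.GroupTheoreticMatMulThmBProofs

/-!
# Per-member translations preserve STPP families in abelian groups

In an abelian group the simultaneous triple product property (Cohn–Kleinberg–Szegedy–Umans 2005, Def. 5.1;
one-clause form of Blasiak–Church–Cohn–Grochow–Naslund–Sawin–Umans 2017, Def. 2.2) of a family
`(Aᵢ, Bᵢ, Cᵢ)ᵢ` is preserved when EACH member is translated by its own element `tᵢ`, the same for its
three sets: `(Aᵢ + tᵢ, Bᵢ + tᵢ, Cᵢ + tᵢ)ᵢ`.  Indeed in the defining word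
`(s′ − s) + (t′ − t) + (u′ − u)` with `s ∈ A_k, s′ ∈ A_i, t ∈ B_i, t′ ∈ B_j, u ∈ C_j, u′ ∈ C_k` every
translation `tᵢ, tⱼ, t_k` enters once with each sign.  (Translating the three sets of one member by
DIFFERENT elements does not preserve the property in general.)  This is the symmetry behind the
`2n³` "fat partners" `(P₁ + t, P₂ + t, P₀ + t)`, `(P₂ + t, P₀ + t, P₁ + t)` of the punctured-axes triple in
`(ℤ/n)³` (cell mm-stpp), and it lets census engines quotient their search pools by per-member translation.

* `AddSimultaneousTPP.translate` — CKSU convention (`Literature.Combinatorics.Additive.AddSimultaneousTPP`);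
* `IsSTPP.translate` — census convention (`Literature.Computability.AlgebraicComplexity.IsSTPP`).

## References
* [CohnKleinbergSzegedyUmans2005] H. Cohn, R. Kleinberg, B. Szegedy, C. Umans, FOCS 2005, Def. 5.1.
* [BlasiakChurchCohnGrochowNaslundSawinUmans2017] Discrete Analysis 2017:3, Def. 2.2.
-/

namespace Literature.Computability.AlgebraicComplexity

open Finset Literature.Combinatorics.Additive

variable {H : Type*} [AddCommGroup H] [DecidableEq H]

/-- **Per-member translation invariance of the STPP** (abelian groups, CKSU convention): if
`(Aᵢ, Bᵢ, Cᵢ)ᵢ` is an STPP family then so is `(Aᵢ + tᵢ, Bᵢ + tᵢ, Cᵢ + tᵢ)ᵢ` for any `t : ι → H`.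
[cite: CohnKleinbergSzegedyUmans2005, Def. 5.1] -/
theorem _root_.Literature.Combinatorics.Additive.AddSimultaneousTPP.translate {ι : Type*}
    {A B C : ι → Finset H} (h : AddSimultaneousTPP A B C) (t : ι → H) :
    AddSimultaneousTPP (fun i => (A i).image (· + t i)) (fun i => (B i).image (· + t i))
      (fun i => (C i).image (· + t i)) := by
  rw [addSimultaneousTPP_iff_forall] at h ⊢
  intro i j k s hs s' hs' v hv v' hv' u hu u' hu' he
  obtain ⟨a, ha, rfl⟩ := Finset.mem_image.1 hs
  obtain ⟨a', ha', rfl⟩ := Finset.mem_image.1 hs'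
  obtain ⟨b, hb, rfl⟩ := Finset.mem_image.1 hv
  obtain ⟨b', hb', rfl⟩ := Finset.mem_image.1 hv'
  obtain ⟨c, hc, rfl⟩ := Finset.mem_image.1 hu
  obtain ⟨c', hc', rfl⟩ := Finset.mem_image.1 hu'
  have key : (a' - a) + (b' - b) + (c' - c) = 0 := by
    rw [← he]; abel
  obtain ⟨hij, hjk, e1, e2, e3⟩ := h i j k a ha a' ha' b hb b' hb' c hc c' hc' key
  subst hij; subst hjk
  exact ⟨rfl, rfl, by rw [e1], by rw [e2], by rw [e3]⟩

/-- **Per-member translation invariance of the STPP**, census convention `IsSTPP` (families indexed by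
`Fin N`). [cite: BlasiakChurchCohnGrochowNaslundSawinUmans2017, Def. 2.2] -/
theorem IsSTPP.translate {N : ℕ} {A B C : Fin N → Finset H} (h : IsSTPP A B C) (t : Fin N → H) :
    IsSTPP (fun i => (A i).image (· + t i)) (fun i => (B i).image (· + t i))
      (fun i => (C i).image (· + t i)) := by
  rw [isSTPP_iff_addSimultaneousTPP] at h ⊢
  exact h.translate t

end Literature.Computability.AlgebraicComplexity
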